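import Summits.ResolutionOfSingularities.ResolutionOfSingularities.Theorems.EquisingularLiftEquisingularLiftNatFirstOrderStrictTransform
import Summits.ResolutionOfSingularities.ResolutionOfSingularities.Theorems.EquisingularLiftEquisingularLiftNatOneStepPoints
import Summits.ResolutionOfSingularities.ResolutionOfSingularities.Theorems.EquisingularLiftEquisingularLiftNatMultiOrdinaryPointsJacobian
import HarnessLib

/-!
# [OURS] EL♮ FOR EVERY HYPERSURFACE WHOSE SINGULAR POINTS ARE FIRST-ORDER POINTS AT COORDINATE VERTICES — every dimension, every characteristic
# (cruxes `Theses.EquisingularLift.EquisingularLiftNat` / `…NatThree`, stmt-ResolutionOfSingularities-20038 / -20148)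

[OURS · leafhand-res-equisingularlift-9 g0, 2026-08-31; cell `pub/decomp-res`] AI-produced, weaker than expert review; NOT a statement of any manuscript;
nothing here proves resolution of singularities in positive characteristic.  DEF-FREE helper; no `sorry`; standard axioms; ZERO named hypotheses.

A marked vertex `P_c` of `H = V₊(F) ⊂ ℙ^{m+2}_K` is a FIRST-ORDER POINT if its chart splits as `F(x_c := 1) = Φ + Ψ₁ + Ψ'` — `Φ ≠ 0` the tangent cone
(a form of degree `μ ≥ 1`), `Ψ₁` the next form (degree `μ + 1`), `Ψ' ∈ (y)^{μ+2}` — with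

  (FO) `Φ`, all `∂Φ/∂y_i` and `Ψ₁` have no common non-zero zero (every prime containing them contains all `y_i`),

i.e. the strict transform of `H` under the blow-up of `P_c` is non-singular along the exceptional divisor (the classical first-order test; ordinary multiple
points are the case `V(Φ)` non-singular, and `A₂` points / characteristic-2 nodes are first-order but not ordinary — `firstOrder_A₂`, `firstOrder_node`).
By ✓ `FirstOrderPoint.exists_strictTransform` (…NatFirstOrderStrictTransform) a first-order point is a ONE-STEP point of seat res-D-pv-013's T-ONESTEP
with EXPLICIT strict transforms, so:

* ★★ `FirstOrderPoint.elNatAt_firstOrderPoints` — **EL♮ (`Theorems.EquisingularLift.ELNatAt`) for every prime form `F ∈ K[x₀,…,x_{m+2}]` (`K = K̄` of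
  characteristic `p`, ANY `m`, ANY degree) whose marked vertices `c ∈ S` are first-order points, the charts `F(x_c := 1)` being singular at most at the
  origin and the charts `c ∉ S` regular** — witness `O = 𝕎(K)`, ONE blow-up of `ℙ^{m+2}_O` along the product of the `O`-points through the `P_c`
  (✓ `OneStep.elNatAt_oneStepPoints`);
* ★★ `FirstOrderPoint.elNatAt_firstOrderPoints_of_jacobian` — the same under the hypotheses a geometer checks on CLOSED POINTS: (jac) «the singular
  points of `V₊(F)` are among the marked vertices» (✓ `MultiOrd.hsing_of_jacobian` / ✓ `MultiOrd.isRegularRing_chartRing_of_jacobian`) and (FO) in the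
  form «`Φ(b) = ∇Φ(b) = Ψ₁(b) = 0` only for `b = 0`» (✓ `FirstOrderPoint.firstOrder_of_forall_aeval`);
* ★ `FirstOrderPoint.elNatAt_of_range_eq_firstOrderPoints_of_jacobian` — the same for every binder `(H, ι)` of the crux with `range ι = V₊(F)`
  (✓ `LinAutTransport.elNatAt_of_range_eq`);
* `FirstOrderPoint.firstOrder_A₂` / `FirstOrderPoint.firstOrder_node` — the criterion (FO) for the `A₂` chart `y₀y₁ + y₂³ + Ψ'` (tangent cone two planes,
  `Ψ₁ = y₂³`) and for the node chart `y₀y₁ + y₂² + Ψ₁ + Ψ'` with `Ψ₁` ARBITRARY, in EVERY characteristic (in characteristic `2` the form `y₀y₁ + y₂²`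
  is not a non-singular form, so T-MULTIORD does not apply, but the point is first-order).

With ✓ `QuadricELNat.elNatAt_of_elNatAt_linSubst` (PGL-transport) this covers every hypersurface whose singular points are `≤ m + 3` first-order points in
linearly general position, ONCE the first-order datum is supplied in the normalised coordinates.  Honest label: closes no registered stub; the by-name
stubs of 20038 / 20148 are untouched.

References: [Hartshorne1977, I Thm. 5.1, I Ex. 5.8, II Ex. 7.12]; [StacksProject, Tags 07PF, 080A, 0804]; [Matsumura1987, Thm. 14.2] — through the cited
tree files.
-/

set_option linter.dupNamespace false -- mandated namespace `Summit.<Summit>.<Problem>` of this single-conjunct summit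

noncomputable section

open CategoryTheory CategoryTheory.Limits AlgebraicGeometry TopologicalSpace
open MvPolynomial HomogeneousLocalization
open Literature.AlgebraicGeometry.Resolution
open Literature.AlgebraicGeometry.Motives Literature.AlgebraicGeometry.Motives.SmoothHypersurface
open Literature.AlgebraicGeometry.Motives.ProjectiveSpace
open AlgebraicGeometry.Scheme.IdealSheafData
open Summit.ResolutionOfSingularities.ResolutionOfSingularities.Cruxes.EquisingularLift.StrataSplit

namespace Summit.ResolutionOfSingularities.ResolutionOfSingularities.Cruxes.EquisingularLiftNat.Sections

namespace FirstOrderPoint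

/-! ## ★★ EL♮ for hypersurfaces with first-order points at coordinate vertices -/

/-- ★★ **EL♮ HOLDS FOR EVERY HYPERSURFACE WHOSE SINGULAR POINTS ARE FIRST-ORDER POINTS AT COORDINATE VERTICES, IN EVERY DIMENSION AND CHARACTERISTIC.**
`K` algebraically closed of characteristic `p`; `F ∈ K[x₀,…,x_{m+2}]` a prime form; `S` a duplicate-free list of coordinates such that for `c ∈ S` the
vertex chart is `F(x_c := 1) = Φ + (Ψ₁ + Ψ')` with `Φ ≠ 0` a form of degree `μ ≥ 1`, `Ψ₁` a form of degree `μ + 1`, `Ψ' ∈ (y)^{μ+2}` and (FO) every prime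
containing `Φ`, all `∂Φ/∂y_i` and `Ψ₁` contains all `y_i`; the affine chart `F(x_c := 1)` singular at most at the origin (prime-ideal Jacobian hypothesis);
the charts `ChartRing F c`, `c ∉ S`, regular.  Then `Theorems.EquisingularLift.ELNatAt p K (m+2) V₊(F) ι`: `O = 𝕎(K)`, ONE blow-up of `ℙ^{m+2}_O` along the
product of the `O`-points through the `P_c` — ✓ `OneStep.elNatAt_oneStepPoints`, its explicit strict transforms supplied by
✓ `FirstOrderPoint.exists_strictTransform`. [OURS] [cite: Hartshorne1977, I Thm. 5.1] [cite: StacksProject, Tag 080A] -/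
theorem elNatAt_firstOrderPoints (p : ℕ) (hp : p.Prime) (K : Type) [Field K] [CharP K p] [IsAlgClosed K] {m : ℕ}
    (F : MvPolynomial (Fin (m + 2 + 1)) K) {d : ℕ} (hF : F.IsHomogeneous d) (hFp : Prime F)
    (S : List (Fin (m + 2 + 1))) (hS : S.Nodup)
    (hfo : ∀ c ∈ S, ∃ (μ : ℕ) (Φ Ψ₁ Ψ' : MvPolynomial (Fin (m + 2)) K), 1 ≤ μ ∧ Φ.IsHomogeneous μ ∧ Φ ≠ 0 ∧ Ψ₁.IsHomogeneous (μ + 1) ∧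
      Ψ' ∈ Ideal.span (Set.range (X : Fin (m + 2) → MvPolynomial (Fin (m + 2)) K)) ^ (μ + 2) ∧ ProjectiveSpace.dehomogenize K c F = Φ + (Ψ₁ + Ψ') ∧
      ∀ P : Ideal (MvPolynomial (Fin (m + 2)) K), P.IsPrime → Φ ∈ P → (∀ i, pderiv i Φ ∈ P) → Ψ₁ ∈ P →
        ∀ i, (X i : MvPolynomial (Fin (m + 2)) K) ∈ P)
    (hsing : ∀ c ∈ S, ∀ P : Ideal (MvPolynomial (Fin (m + 2)) K), P.IsPrime → ProjectiveSpace.dehomogenize K c F ∈ P →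
      (∀ j, pderiv j (ProjectiveSpace.dehomogenize K c F) ∈ P) → ∀ j, (X j : MvPolynomial (Fin (m + 2)) K) ∈ P)
    (hoffS : letI := MvPolynomial.gradedAlgebra (σ := Fin (m + 2 + 1)) (R := K)
      ∀ c, c ∉ S → IsRegularRing (ChartRing F c hF)) :
    letI := MvPolynomial.gradedAlgebra (σ := Fin (m + 2 + 1)) (R := K)
    Theorems.EquisingularLift.ELNatAt p K (m + 2) (hypersurface F).left (hypersurfaceι F).left := by
  letI := MvPolynomial.gradedAlgebra (σ := Fin (m + 2 + 1)) (R := K)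
  refine OneStep.elNatAt_oneStepPoints p hp K F hF hFp S hS (fun c hc => ?_) hsing hoffS
  obtain ⟨μ, Φ, Ψ₁, Ψ', hμ, hΦ, hΦ0, hΨ₁, hΨ', hdeh, hcrit⟩ := hfo c hc
  exact ⟨μ, Φ, Ψ₁ + Ψ', hμ, hΦ, hΦ0, add_mem_pow_succ K hΨ₁ hΨ', hdeh,
    fun l => exists_strictTransform K Φ Ψ₁ Ψ' hΦ hΨ₁ hΨ' hcrit l⟩

/-! ## ★★ The classical form: hypotheses on closed points -/

/-- ★★ **EL♮ FOR HYPERSURFACES WITH FIRST-ORDER POINTS AT COORDINATE VERTICES — classical form, every dimension, every characteristic.**  `K` algebraically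
closed of characteristic `p`; `F ∈ K[x₀,…,x_{m+2}]` a prime form; `S` a duplicate-free list of coordinates; (jac) every `a ≠ 0` in `K^{m+3}` with `F(a) = 0` and
`∇F(a) = 0` is a multiple of some `e_c`, `c ∈ S` («the singular points of `V₊(F)` are among the marked vertices»); (fo) for `c ∈ S` the vertex chart is
`F(x_c := 1) = Φ + (Ψ₁ + Ψ')`, `Φ ≠ 0` a form of degree `μ ≥ 1`, `Ψ₁` a form of degree `μ + 1`, `Ψ' ∈ (y)^{μ+2}`, and `b = 0` is the only point of `K^{m+2}` with
`Φ(b) = 0`, `∇Φ(b) = 0`, `Ψ₁(b) = 0`.  Then `Theorems.EquisingularLift.ELNatAt p K (m+2) V₊(F) ι` (✓ `elNatAt_firstOrderPoints` with (hsing)/(hoffS) from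
✓ `MultiOrd.hsing_of_jacobian` / ✓ `MultiOrd.isRegularRing_chartRing_of_jacobian` and (FO) from ✓ `firstOrder_of_forall_aeval`).
[OURS] [cite: Hartshorne1977, I Thm. 5.1] [cite: StacksProject, Tag 07PF] -/
theorem elNatAt_firstOrderPoints_of_jacobian (p : ℕ) (hp : p.Prime) (K : Type) [Field K] [CharP K p] [IsAlgClosed K] {m : ℕ}
    (F : MvPolynomial (Fin (m + 2 + 1)) K) {d : ℕ} (hF : F.IsHomogeneous d) (hFp : Prime F)
    (S : List (Fin (m + 2 + 1))) (hS : S.Nodup)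
    (hjac : ∀ a : Fin (m + 2 + 1) → K, a ≠ 0 → eval a F = 0 → (∀ i, eval a (pderiv i F) = 0) → ∃ c ∈ S, ∀ i, i ≠ c → a i = 0)
    (hfo : ∀ c ∈ S, ∃ (μ : ℕ) (Φ Ψ₁ Ψ' : MvPolynomial (Fin (m + 2)) K), 1 ≤ μ ∧ Φ.IsHomogeneous μ ∧ Φ ≠ 0 ∧ Ψ₁.IsHomogeneous (μ + 1) ∧
      Ψ' ∈ Ideal.span (Set.range (X : Fin (m + 2) → MvPolynomial (Fin (m + 2)) K)) ^ (μ + 2) ∧ ProjectiveSpace.dehomogenize K c F = Φ + (Ψ₁ + Ψ') ∧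
      ∀ b : Fin (m + 2) → K, aeval b Φ = 0 → (∀ i, aeval b (pderiv i Φ) = 0) → aeval b Ψ₁ = 0 → b = 0) :
    letI := MvPolynomial.gradedAlgebra (σ := Fin (m + 2 + 1)) (R := K)
    Theorems.EquisingularLift.ELNatAt p K (m + 2) (hypersurface F).left (hypersurfaceι F).left := by
  letI := MvPolynomial.gradedAlgebra (σ := Fin (m + 2 + 1)) (R := K)
  refine elNatAt_firstOrderPoints p hp K F hF hFp S hS (fun c hc => ?_)
    (fun c _ P hP hf hPj j => MultiOrd.hsing_of_jacobian F hF S hjac c P hP hf hPj j)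
    (fun c hc => MultiOrd.isRegularRing_chartRing_of_jacobian F hF S hjac hFp c hc)
  obtain ⟨μ, Φ, Ψ₁, Ψ', hμ, hΦ, hΦ0, hΨ₁, hΨ', hdeh, h⟩ := hfo c hc
  exact ⟨μ, Φ, Ψ₁, Ψ', hμ, hΦ, hΦ0, hΨ₁, hΨ', hdeh, fun P hP hΦP hdP hΨP => firstOrder_of_forall_aeval K Φ Ψ₁ h P hP hΦP hdP hΨP⟩

/-- ★ **The same for every binder `(H, ι)` of the crux with `range ι = V₊(F)`** (`ELNatAt` depends on `(H, ι)` only through `range ι`,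
✓ `LinAutTransport.elNatAt_of_range_eq`; `range (hypersurfaceι F) = V₊(F)`, ✓ `range_hypersurfaceι`). [OURS] [cite: Hartshorne1977, I Thm. 5.1] -/
theorem elNatAt_of_range_eq_firstOrderPoints_of_jacobian (p : ℕ) (hp : p.Prime) (K : Type) [Field K] [CharP K p] [IsAlgClosed K] {m : ℕ}
    (F : MvPolynomial (Fin (m + 2 + 1)) K) {d : ℕ} (hF : F.IsHomogeneous d) (hFp : Prime F)
    (S : List (Fin (m + 2 + 1))) (hS : S.Nodup)
    (hjac : ∀ a : Fin (m + 2 + 1) → K, a ≠ 0 → eval a F = 0 → (∀ i, eval a (pderiv i F) = 0) → ∃ c ∈ S, ∀ i, i ≠ c → a i = 0)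
    (hfo : ∀ c ∈ S, ∃ (μ : ℕ) (Φ Ψ₁ Ψ' : MvPolynomial (Fin (m + 2)) K), 1 ≤ μ ∧ Φ.IsHomogeneous μ ∧ Φ ≠ 0 ∧ Ψ₁.IsHomogeneous (μ + 1) ∧
      Ψ' ∈ Ideal.span (Set.range (X : Fin (m + 2) → MvPolynomial (Fin (m + 2)) K)) ^ (μ + 2) ∧ ProjectiveSpace.dehomogenize K c F = Φ + (Ψ₁ + Ψ') ∧
      ∀ b : Fin (m + 2) → K, aeval b Φ = 0 → (∀ i, aeval b (pderiv i Φ) = 0) → aeval b Ψ₁ = 0 → b = 0)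
    {H : Scheme.{0}} (ι : H ⟶ (projectiveSpace (m + 2) K).left)
    (hrange : letI := MvPolynomial.gradedAlgebra (σ := Fin (m + 2 + 1)) (R := K)
      Set.range ι = {x : Proj (homogeneousSubmodule (Fin (m + 2 + 1)) K) | F ∈ x.asHomogeneousIdeal}) :
    Theorems.EquisingularLift.ELNatAt p K (m + 2) H ι := by
  letI := MvPolynomial.gradedAlgebra (σ := Fin (m + 2 + 1)) (R := K)
  refine LinAutTransport.elNatAt_of_range_eq p K (m + 2) ι (hypersurfaceι F).left ?_
    (elNatAt_firstOrderPoints_of_jacobian p hp K F hF hFp S hS hjac hfo)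
  rw [hrange, range_hypersurfaceι]
  ext x
  refine ⟨fun h => (ProjectiveSpectrum.mem_zeroLocus _ _ _).mpr (Set.singleton_subset_iff.mpr h), fun h => ?_⟩
  have h' : F ∈ (x.asHomogeneousIdeal : Set (MvPolynomial (Fin (m + 2 + 1)) K)) :=
    Set.singleton_subset_iff.mp ((ProjectiveSpectrum.mem_zeroLocus _ _ _).mp h)
  exact h'

/-! ## The criterion (FO) for the `A₂` chart and for the node chart, every characteristic -/

/-- **`A₂` charts are first-order**: in `K[y₀, y₁, y₂]` (the surface case) the tangent cone `Φ = y₀y₁` (two planes) with next form `Ψ₁ = y₂³`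
satisfies (FO): a prime containing `∂₀Φ = y₁`, `∂₁Φ = y₀` and `y₂³` contains `y₀, y₁, y₂`.  EVERY
characteristic (including `2` and `3`). [folklore] -/
theorem firstOrder_A₂ (K : Type) [Field K] (P : Ideal (MvPolynomial (Fin 3) K)) (hP : P.IsPrime)
    (_hΦ : (X 0 * X 1 : MvPolynomial (Fin 3) K) ∈ P) (hd : ∀ i, pderiv i (X 0 * X 1 : MvPolynomial (Fin 3) K) ∈ P)
    (hΨ : (X 2 ^ 3 : MvPolynomial (Fin 3) K) ∈ P) (i : Fin 3) : (X i : MvPolynomial (Fin 3) K) ∈ P := by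
  have h0 : (X 1 : MvPolynomial (Fin 3) K) ∈ P := by
    have h := hd 0
    rwa [pderiv_mul, pderiv_X_self, pderiv_X_of_ne (by decide : (1 : Fin 3) ≠ 0), one_mul, mul_zero, add_zero] at h
  have h1 : (X 0 : MvPolynomial (Fin 3) K) ∈ P := by
    have h := hd 1
    rwa [pderiv_mul, pderiv_X_of_ne (by decide : (0 : Fin 3) ≠ 1), pderiv_X_self, zero_mul, zero_add, mul_one] at h
  have h2 : (X 2 : MvPolynomial (Fin 3) K) ∈ P := hP.mem_of_pow_mem 3 hΨ
  fin_cases i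
  · exact h1
  · exact h0
  · exact h2

/-- **Node charts are first-order in EVERY characteristic**: the tangent cone `Φ = y₀y₁ + y₂²` with ANY next form `Ψ₁` satisfies (FO) — a prime containing
`Φ`, `∂₀Φ = y₁` and `∂₁Φ = y₀` contains `y₂²`, hence `y₂`.  (In characteristic `2` all partials of `Φ` vanish at `[0:0:1]`, so `Φ` is not a non-singular
form in the sense of ✓ `IsNonsingularForm` and T-MULTIORD does not apply; the point is nevertheless resolved by one blow-up.) [folklore] -/
theorem firstOrder_node (K : Type) [Field K] (Ψ₁ : MvPolynomial (Fin 3) K) (P : Ideal (MvPolynomial (Fin 3) K)) (hP : P.IsPrime)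
    (hΦ : (X 0 * X 1 + X 2 ^ 2 : MvPolynomial (Fin 3) K) ∈ P) (hd : ∀ i, pderiv i (X 0 * X 1 + X 2 ^ 2 : MvPolynomial (Fin 3) K) ∈ P)
    (_hΨ : Ψ₁ ∈ P) (i : Fin 3) : (X i : MvPolynomial (Fin 3) K) ∈ P := by
  have h0 : (X 1 : MvPolynomial (Fin 3) K) ∈ P := by
    have h := hd 0
    rwa [map_add, pderiv_mul, pderiv_X_self, pderiv_X_of_ne (by decide : (1 : Fin 3) ≠ 0), one_mul, mul_zero, add_zero, pderiv_pow,
      pderiv_X_of_ne (by decide : (2 : Fin 3) ≠ 0), mul_zero, add_zero] at h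
  have h1 : (X 0 : MvPolynomial (Fin 3) K) ∈ P := by
    have h := hd 1
    rwa [map_add, pderiv_mul, pderiv_X_of_ne (by decide : (0 : Fin 3) ≠ 1), pderiv_X_self, zero_mul, zero_add, mul_one, pderiv_pow,
      pderiv_X_of_ne (by decide : (2 : Fin 3) ≠ 1), mul_zero, add_zero] at h
  have h2 : (X 2 : MvPolynomial (Fin 3) K) ∈ P := by
    have h : (X 2 ^ 2 : MvPolynomial (Fin 3) K) = (X 0 * X 1 + X 2 ^ 2) - X 0 * X 1 := by ring
    exact hP.mem_of_pow_mem 2 (h ▸ P.sub_mem hΦ (P.mul_mem_left _ h0))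
  fin_cases i
  · exact h1
  · exact h0
  · exact h2

end FirstOrderPoint

end Summit.ResolutionOfSingularities.ResolutionOfSingularities.Cruxes.EquisingularLiftNat.Sections

end
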